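import Mathlib
import Literature.Analysis.FluidPDE.ClassicalSolution
import Literature.Analysis.FluidPDE.LerayHopf
import Literature.Analysis.FluidPDE.LerayHopfProofs
import Literature.Analysis.FluidPDE.TaoLocalisationHolds
import Literature.Analysis.FluidPDE.TaoEnstrophyLocalisation
import Literature.Analysis.FluidPDE.AxisymmetricNoSwirlWeightedEnstrophyProofs
import Summits.NavierStokesRegularity.NavierStokesRegularity.Theorems.PlaneEnergyCeilingPlanarEnergyAPrioriClosedSlab
import HarnessLib

/-!
# Route ContinuousAlignment, crux `AprioriContinuousAlignment` (stmt-NavierStokesRegularity-18585),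
# line `birth`, stub `stub_regularAligned`: the regular case of a-priori continuous alignment

What is proved (`stub_regularAligned`, registered stub of the birth skeleton
`Cruxes/AprioriContinuousAlignment/Lines/birth.lean`): if a classical solution `(u, p)` of the
unforced Navier–Stokes system (`ν > 0`) on `ℝ³ × [0, T)`, Leray–Hopf from its rapidly decaying
datum `u 0`, extends classically past `T` (`HasSmoothExtensionPast ν 0 u T`), then for every
vorticity threshold `d > 0` the vorticity direction `ξ = ω/|ω|` has a `t`-UNIFORM spatial modulus
of continuity on the high set `{|ω(t, ·)| > d}`, `t ∈ [0, T)`, in the route's sine form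
`√(1 - ⟪ξ(t,x), ξ(t,y)⟫²) ≤ ε` for `‖x - y‖ < δ`. All open content of the crux W1 sits in the
complementary (singular) stub; this is the provable half.

## Proof

1. *Closed slab.* The extension `(u', p')` on `[0, T')`, `T' > T`, is classical on the CLOSED slab
   `[0, T]` (`IsClassicalNSSolutionOn.mono`); its energy there is bounded by `2E(u 0)` (Leray–Hopf
   energy inequality for `t < T`, Fatou at `t = T`:
   `PlanarEnergyAPriori.lintegral_enorm_sq_le_of_extension`), and its datum is the rapidly
   decaying `u 0`; so Tao 2013 (Cor. 11.1 + Cor. 4.3 + Thm. 5.4 (iv), the tree's THEOREM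
   `tao2011_hasBoundedSobolevNormsOn_holds`) bounds all its Sobolev norms on `[0, T]`.
2. *Uniform Lipschitz bound of the vorticity.* The Sobolev imbedding `H² ⊂ C_B`
   (`exists_forall_norm_le_of_sobolev_bounds`) applied to the second derivative `D²u'` gives
   `‖D²u'(t, x)‖ ≤ B` on `[0, T] × ℝ³`; the mean value inequality makes `Du'(t, ·)` `B`-Lipschitz,
   and `curl = curlCLM ∘ D` makes `ω(t, ·) = curl u(t, ·)` `L`-Lipschitz with
   `L = ‖curlCLM‖ B + 1`, uniformly in `t ∈ [0, T)`.
3. *Unit-vector geometry.* For `‖a‖, ‖b‖ > d`: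
   `√(1 - ⟪â, b̂⟫²) ≤ ‖â - b̂‖ ≤ 2‖a - b‖/d` (`sqrt_one_sub_inner_sq_le_norm_sub`,
   `norm_normalize_sub_normalize_le`), so `δ = εd/(2L)` works.

## References

* T. Tao, *Localisation and compactness properties of the Navier–Stokes global regularity
  problem*, Anal. PDE 6 (2013) = arXiv:1108.1165, Cor. 11.1, Cor. 4.3, Thm. 5.4 (iv). [Tao2011]
* P. Constantin, C. Fefferman, Indiana Univ. Math. J. 42 (1993) 775–789 (the sine of the angle of
  vorticity directions as the measure of alignment). [ConstantinFefferman1993]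
-/

noncomputable section

-- the summit and its single sub-problem share the name (CONVENTIONS §1), as in every Theorems file
set_option linter.dupNamespace false

open Set Function MeasureTheory Filter
open scoped RealInnerProductSpace Topology ENNReal NNReal

namespace Summit.NavierStokesRegularity.NavierStokesRegularity.Theorems

open Literature.Analysis.FluidPDE

/-! ### Unit-vector geometry -/

/-- **Chord bound for normalised vectors**: for `a ≠ 0` and any `b`,
`‖a/‖a‖ - b/‖b‖‖ ≤ 2‖a - b‖/‖a‖` (write `a/‖a‖ - b/‖b‖ = (a - b)/‖a‖ + (1/‖a‖ - 1/‖b‖) b` and use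
`|‖b‖ - ‖a‖| ≤ ‖a - b‖`; for `b = 0` the left side is `1 ≤ 2`). [folklore] -/
theorem norm_normalize_sub_normalize_le (a b : EuclideanSpace ℝ (Fin 3)) (ha : a ≠ 0) :
    ‖‖a‖⁻¹ • a - ‖b‖⁻¹ • b‖ ≤ 2 * ‖a - b‖ / ‖a‖ := by
  have hna : 0 < ‖a‖ := norm_pos_iff.2 ha
  by_cases hb : b = 0
  · subst hb
    simp only [norm_zero, inv_zero, smul_zero, sub_zero]
    rw [norm_smul, norm_inv, norm_norm, inv_mul_cancel₀ hna.ne', le_div_iff₀ hna]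
    linarith
  have hnb : 0 < ‖b‖ := norm_pos_iff.2 hb
  have hdecomp : ‖a‖⁻¹ • a - ‖b‖⁻¹ • b = ‖a‖⁻¹ • (a - b) + (‖a‖⁻¹ - ‖b‖⁻¹) • b := by
    rw [smul_sub, sub_smul]
    abel
  have h1 : ‖‖a‖⁻¹ • (a - b)‖ = ‖a - b‖ / ‖a‖ := by
    rw [norm_smul, norm_inv, norm_norm, div_eq_inv_mul]
  have h2 : ‖(‖a‖⁻¹ - ‖b‖⁻¹) • b‖ ≤ ‖a - b‖ / ‖a‖ := by
    have h3 : |‖b‖ - ‖a‖| ≤ ‖a - b‖ := by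
      rw [abs_sub_comm]; exact abs_norm_sub_norm_le a b
    have hane : ‖a‖ ≠ 0 := hna.ne'
    have hbne : ‖b‖ ≠ 0 := hnb.ne'
    have e : ‖(‖a‖⁻¹ - ‖b‖⁻¹) • b‖ = |‖b‖ - ‖a‖| / ‖a‖ := by
      rw [norm_smul, Real.norm_eq_abs, inv_sub_inv hane hbne, abs_div, abs_mul,
        abs_of_pos hna, abs_of_pos hnb]
      field_simp
    rw [e]
    exact div_le_div_of_nonneg_right h3 hna.le
  calc ‖‖a‖⁻¹ • a - ‖b‖⁻¹ • b‖ = ‖‖a‖⁻¹ • (a - b) + (‖a‖⁻¹ - ‖b‖⁻¹) • b‖ := by rw [hdecomp]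
    _ ≤ ‖‖a‖⁻¹ • (a - b)‖ + ‖(‖a‖⁻¹ - ‖b‖⁻¹) • b‖ := norm_add_le _ _
    _ ≤ ‖a - b‖ / ‖a‖ + ‖a - b‖ / ‖a‖ := by rw [h1]; linarith [h2]
    _ = 2 * ‖a - b‖ / ‖a‖ := by ring

/-- **The sine is below the chord**: for unit vectors `a`, `b`,
`√(1 - ⟪a, b⟫²) ≤ ‖a - b‖` (`1 - ⟪a,b⟫² = (1 - ⟪a,b⟫)(1 + ⟪a,b⟫) ≤ 2(1 - ⟪a,b⟫) = ‖a - b‖²`).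
[folklore] -/
theorem sqrt_one_sub_inner_sq_le_norm_sub (a b : EuclideanSpace ℝ (Fin 3)) (ha : ‖a‖ = 1)
    (hb : ‖b‖ = 1) : Real.sqrt (1 - ⟪a, b⟫ ^ 2) ≤ ‖a - b‖ := by
  have hsq : ‖a - b‖ ^ 2 = 2 - 2 * ⟪a, b⟫ := by
    rw [@norm_sub_sq_real, ha, hb]
    ring
  have hle1 : ⟪a, b⟫ ≤ 1 := by
    have h := real_inner_le_norm a b
    rw [ha, hb, mul_one] at h
    exact h
  have hge1 : -1 ≤ ⟪a, b⟫ := by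
    have h := neg_le_of_abs_le (abs_real_inner_le_norm a b)
    rw [ha, hb, mul_one] at h
    exact h
  have key : 1 - ⟪a, b⟫ ^ 2 ≤ ‖a - b‖ ^ 2 := by
    rw [hsq]
    nlinarith
  calc Real.sqrt (1 - ⟪a, b⟫ ^ 2) ≤ Real.sqrt (‖a - b‖ ^ 2) := Real.sqrt_le_sqrt key
    _ = ‖a - b‖ := Real.sqrt_sq (norm_nonneg _)

/-- **The sine of the angle of two super-threshold vectors is controlled by their difference**:
if `d < ‖a‖`, `d < ‖b‖`, `0 < d`, then `√(1 - ⟪a/‖a‖, b/‖b‖⟫²) ≤ 2‖a - b‖/d`. [folklore] -/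
theorem sqrt_one_sub_inner_normalize_sq_le {d : ℝ} (hd : 0 < d) (a b : EuclideanSpace ℝ (Fin 3))
    (ha : d < ‖a‖) (hb : d < ‖b‖) :
    Real.sqrt (1 - ⟪‖a‖⁻¹ • a, ‖b‖⁻¹ • b⟫ ^ 2) ≤ 2 * ‖a - b‖ / d := by
  have hna : 0 < ‖a‖ := hd.trans ha
  have hnb : 0 < ‖b‖ := hd.trans hb
  have ha0 : a ≠ 0 := norm_pos_iff.1 hna
  have hb0 : b ≠ 0 := norm_pos_iff.1 hnb
  calc Real.sqrt (1 - ⟪‖a‖⁻¹ • a, ‖b‖⁻¹ • b⟫ ^ 2)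
      ≤ ‖‖a‖⁻¹ • a - ‖b‖⁻¹ • b‖ :=
        sqrt_one_sub_inner_sq_le_norm_sub _ _ (norm_smul_inv_norm ha0) (norm_smul_inv_norm hb0)
    _ ≤ 2 * ‖a - b‖ / ‖a‖ := norm_normalize_sub_normalize_le a b ha0
    _ ≤ 2 * ‖a - b‖ / d := by
        apply div_le_div_of_nonneg_left (by positivity) hd ha.le

/-! ### A solution that extends past `T` has uniformly Lipschitz vorticity on `[0, T)` -/

/-- **Uniform spatial Lipschitz bound of the vorticity below a regular time.** Let `u` be
Leray–Hopf on `[0,T)` from the rapidly decaying datum `u 0` and let `(u', p')` be a classical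
extension to `[0,T')`, `T' > T`, agreeing with `u` on `[0,T)`. Then there is one constant `L > 0`
with `‖curl u(t,x) - curl u(t,y)‖ ≤ L‖x - y‖` for all `t ∈ [0,T)`, `x`, `y`: the extension is
classical on the closed slab `[0,T]` with energy `≤ 2E(u 0)` (Fatou at `t = T`), so Tao 2013 bounds
all its Sobolev norms on `[0,T]`; the imbedding `H² ⊂ C_B` applied to `D²u'` bounds the Hessian,
the mean value inequality makes `Du'(t,·)` Lipschitz, and `curl = curlCLM ∘ D`.
[cite: Tao2011, Cor. 11.1 + Cor. 4.3 + Thm. 5.4 (iv)] -/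
theorem exists_lipschitz_curl_of_hasSmoothExtensionPast {ν T : ℝ} (hν : 0 < ν) (hT : 0 < T)
    {u : ℝ → EuclideanSpace ℝ (Fin 3) → EuclideanSpace ℝ (Fin 3)}
    (hLH : IsLerayHopfOn T ν 0 (u 0) u) (hdec : HasRapidSpatialDecay (u 0))
    (hext : HasSmoothExtensionPast ν 0 u T) :
    ∃ L : ℝ, 0 < L ∧ ∀ t ∈ Ico 0 T, ∀ x y : EuclideanSpace ℝ (Fin 3),
      ‖curl (u t) x - curl (u t) y‖ ≤ L * ‖x - y‖ := by
  obtain ⟨T', hT', u', p', hcl', hagree⟩ := hext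
  -- the extension on the closed slab `[0,T]`
  have hsol : IsClassicalNSSolutionOn (Icc 0 T) ν 0 u' p' :=
    hcl'.mono (Icc_subset_Ico_right hT') (uniqueDiffOn_Icc hT)
  -- energy on `[0,T]`: Leray–Hopf below `T`, Fatou at `T`
  set K : ℝ≥0∞ := ENNReal.ofReal (2 * VectorCalculus.kineticEnergy (u 0)) with hK
  have hE₀ : ∀ t ∈ Ico 0 T, ∫⁻ x, ‖u' t x‖ₑ ^ 2 ≤ K := fun t ht => by
    rw [hagree t ht]
    exact hLH.lintegral_enorm_sq_le hν.le ⟨ht.1, ht.2.le⟩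
  have hET : ∫⁻ x, ‖u' T x‖ₑ ^ 2 ≤ K :=
    PlanarEnergyAPriori.lintegral_enorm_sq_le_of_extension hcl'.smooth_velocity hT hT' hE₀
  have hE : ∃ C : ℝ≥0, ∀ t ∈ Icc 0 T, ∫⁻ x, ‖u' t x‖ₑ ^ 2 ≤ C := by
    refine ⟨(2 * VectorCalculus.kineticEnergy (u 0)).toNNReal, fun t ht => ?_⟩
    rcases ht.2.eq_or_lt with h | h
    · rw [h]; exact hET
    · exact hE₀ t ⟨ht.1, h⟩
  have hdec' : HasRapidSpatialDecay (u' 0) := by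
    rw [hagree 0 ⟨le_rfl, hT⟩]
    exact hdec
  -- Tao: bounded Sobolev norms on `[0,T]`
  have hH : HasBoundedSobolevNormsOn (Icc 0 T) u' :=
    tao2011_hasBoundedSobolevNormsOn_holds hν hT hsol hE hdec'
  -- Sobolev imbedding applied to the Hessian `D²u'`
  set g : ℝ → EuclideanSpace ℝ (Fin 3) →
      (EuclideanSpace ℝ (Fin 3) →L[ℝ] EuclideanSpace ℝ (Fin 3) →L[ℝ] EuclideanSpace ℝ (Fin 3)) :=
    fun t => fderiv ℝ (fderiv ℝ (u' t)) with hg_def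
  have hg : ∀ t ∈ Icc 0 T, ContDiff ℝ 2 (g t) := by
    intro t ht
    have hu : ContDiff ℝ 4 (u' t) := (hsol.contDiff_velocity ht).of_le (by norm_cast)
    exact (hu.fderiv_right (m := 3) (by norm_num)).fderiv_right (m := 2) (by norm_num)
  have hHg : ∀ j < 3, ∃ C : ℝ≥0, ∀ t ∈ Icc 0 T,
      ∫⁻ x, ‖iteratedFDeriv ℝ j (g t) x‖ₑ ^ 2 ≤ C := by
    intro j _
    obtain ⟨C, hC⟩ := hH (j + 1 + 1)
    refine ⟨C, fun t ht => le_of_eq_of_le (lintegral_congr fun x => ?_) (hC t ht)⟩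
    rw [← ofReal_norm, hg_def, norm_iteratedFDeriv_fderiv, norm_iteratedFDeriv_fderiv, ofReal_norm]
  obtain ⟨B, hB0, hB⟩ := exists_forall_norm_le_of_sobolev_bounds (S := Icc 0 T) hg hHg
  -- the Lipschitz constant
  refine ⟨‖curlCLM‖ * B + 1, by positivity, fun t ht x y => ?_⟩
  have ht' : t ∈ Icc 0 T := Ico_subset_Icc_self ht
  have hC2 : ContDiff ℝ 2 (u' t) := (hsol.contDiff_velocity ht').of_le (by norm_cast)
  have hdiff : Differentiable ℝ (fderiv ℝ (u' t)) :=
    (hC2.fderiv_right (m := 1) (by norm_num)).differentiable one_ne_zero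
  have hlip : LipschitzWith B.toNNReal (fderiv ℝ (u' t)) := by
    refine lipschitzWith_of_nnnorm_fderiv_le hdiff fun z => ?_
    rw [← NNReal.coe_le_coe, coe_nnnorm, Real.coe_toNNReal B hB0]
    exact hB t ht' z
  have hD : ‖fderiv ℝ (u' t) x - fderiv ℝ (u' t) y‖ ≤ B * ‖x - y‖ := by
    have h := hlip.dist_le_mul x y
    rwa [dist_eq_norm, dist_eq_norm, Real.coe_toNNReal B hB0] at h
  rw [← hagree t ht, curl_eq_curlCLM, curl_eq_curlCLM, ← map_sub]
  calc ‖curlCLM (fderiv ℝ (u' t) x - fderiv ℝ (u' t) y)‖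
      ≤ ‖curlCLM‖ * ‖fderiv ℝ (u' t) x - fderiv ℝ (u' t) y‖ := ContinuousLinearMap.le_opNorm _ _
    _ ≤ ‖curlCLM‖ * (B * ‖x - y‖) := mul_le_mul_of_nonneg_left hD (norm_nonneg curlCLM)
    _ ≤ (‖curlCLM‖ * B + 1) * ‖x - y‖ := by nlinarith [norm_nonneg curlCLM, norm_nonneg (x - y)]

/-! ### The stub -/

/-- **stub `stub_regularAligned` — the REGULAR case of a-priori continuous alignment** (crux W1,
`AprioriContinuousAlignment`, stmt-NavierStokesRegularity-18585, birth line). If the classical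
solution on `ℝ³ × [0, T)` (Leray–Hopf from its rapidly decaying datum) extends classically past
`T`, then for every `d > 0` the vorticity direction has a `t`-uniform modulus of continuity (sine
form) on `{|ω| > d}`, `t ∈ [0, T)`: with the uniform Lipschitz constant `L` of the vorticity
(`exists_lipschitz_curl_of_hasSmoothExtensionPast`) and `δ := εd/(2L)`,
`√(1 - ⟪ξx, ξy⟫²) ≤ 2‖ω(x) - ω(y)‖/d ≤ 2L‖x - y‖/d ≤ ε`. [folklore] -/
theorem stub_regularAligned :
    ∀ (ν T : ℝ), 0 < ν → 0 < T →
      ∀ (u : ℝ → EuclideanSpace ℝ (Fin 3) → EuclideanSpace ℝ (Fin 3)) (p : ℝ → EuclideanSpace ℝ (Fin 3) → ℝ),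
        Literature.Analysis.FluidPDE.IsClassicalNSSolutionOn (Set.Ico 0 T) ν 0 u p →
        Literature.Analysis.FluidPDE.IsLerayHopfOn T ν 0 (u 0) u →
        Literature.Analysis.FluidPDE.HasRapidSpatialDecay (u 0) →
        Literature.Analysis.FluidPDE.HasSmoothExtensionPast ν 0 u T →
        ∀ d : ℝ, 0 < d → ∀ ε : ℝ, 0 < ε → ∃ δ : ℝ, 0 < δ ∧ ∀ t ∈ Set.Ico 0 T,
          ∀ x y : EuclideanSpace ℝ (Fin 3),
            d < ‖Literature.Analysis.FluidPDE.curl (u t) x‖ → d < ‖Literature.Analysis.FluidPDE.curl (u t) y‖ →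
            ‖x - y‖ < δ →
            Real.sqrt (1 - (inner ℝ
              (‖Literature.Analysis.FluidPDE.curl (u t) x‖⁻¹ • Literature.Analysis.FluidPDE.curl (u t) x)
              (‖Literature.Analysis.FluidPDE.curl (u t) y‖⁻¹ • Literature.Analysis.FluidPDE.curl (u t) y)) ^ 2)
              ≤ ε := by
  intro ν T hν hT u p _ hLH hdec hext d hd ε hε
  obtain ⟨L, hL, hlip⟩ := exists_lipschitz_curl_of_hasSmoothExtensionPast hν hT hLH hdec hext
  refine ⟨ε * d / (2 * L), by positivity, fun t ht x y hx hy hxy => ?_⟩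
  have h1 := sqrt_one_sub_inner_normalize_sq_le hd (curl (u t) x) (curl (u t) y) hx hy
  have h2 : ‖curl (u t) x - curl (u t) y‖ ≤ L * ‖x - y‖ := hlip t ht x y
  have h3 : L * ‖x - y‖ ≤ L * (ε * d / (2 * L)) := mul_le_mul_of_nonneg_left hxy.le hL.le
  have h4 : L * (ε * d / (2 * L)) = ε * d / 2 := by field_simp
  have h5 : 2 * ‖curl (u t) x - curl (u t) y‖ / d ≤ ε := by
    rw [div_le_iff₀ hd]
    nlinarith
  exact h1.trans h5

/-! ### Where the open content of W1 sits: compact sub-intervals are free -/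

/-- **A-priori continuous alignment holds on every compact sub-interval `[0, T'']`, `T'' < T`, of
the lifespan — unconditionally.** For a classical solution on `ℝ³ × [0, T)`, Leray–Hopf from its
rapidly decaying datum, and `0 < T'' < T`, the direction modulus of `stub_regularAligned` holds
uniformly in `t ∈ [0, T'')`: the solution itself is a smooth extension of its restriction past
`T''` (`HasSmoothExtensionPast ν 0 u T''` with witness `(T, u, p)`), and the restriction is
classical on `[0, T'')` (`IsClassicalNSSolutionOn.mono`, `uniqueDiffOn_Ico`) and Leray–Hopf on
`[0, T'')` (`IsLerayHopfOn.of_le`). Hence ALL content of the crux `AprioriContinuousAlignment`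
(stmt-NavierStokesRegularity-18585) is the `t`-uniformity of `δ` as `T'' ↑ T` at a first blow-up
time — the registered residual stub `stub_singularAligned`. [folklore] -/
theorem aprioriContinuousAlignment_of_lt {ν T : ℝ} (hν : 0 < ν) (hT : 0 < T)
    {u : ℝ → EuclideanSpace ℝ (Fin 3) → EuclideanSpace ℝ (Fin 3)}
    {p : ℝ → EuclideanSpace ℝ (Fin 3) → ℝ}
    (hcl : IsClassicalNSSolutionOn (Ico 0 T) ν 0 u p) (hLH : IsLerayHopfOn T ν 0 (u 0) u)
    (hdec : HasRapidSpatialDecay (u 0)) {T'' : ℝ} (hT''0 : 0 < T'') (hT'' : T'' < T)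
    {d : ℝ} (hd : 0 < d) {ε : ℝ} (hε : 0 < ε) :
    ∃ δ : ℝ, 0 < δ ∧ ∀ t ∈ Ico 0 T'', ∀ x y : EuclideanSpace ℝ (Fin 3),
      d < ‖curl (u t) x‖ → d < ‖curl (u t) y‖ → ‖x - y‖ < δ →
        Real.sqrt (1 - ⟪‖curl (u t) x‖⁻¹ • curl (u t) x, ‖curl (u t) y‖⁻¹ • curl (u t) y⟫ ^ 2) ≤ ε := by
  have _ := hT
  have hcl'' : IsClassicalNSSolutionOn (Ico 0 T'') ν 0 u p :=
    hcl.mono (Ico_subset_Ico_right hT''.le) (uniqueDiffOn_Ico 0 T'')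
  have hLH'' : IsLerayHopfOn T'' ν 0 (u 0) u := hLH.of_le hT''.le
  have hext : HasSmoothExtensionPast ν 0 u T'' := ⟨T, hT'', u, p, hcl, fun _ _ => rfl⟩
  exact stub_regularAligned ν T'' hν hT''0 u p hcl'' hLH'' hdec hext d hd ε hε

end Summit.NavierStokesRegularity.NavierStokesRegularity.Theorems

end
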